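import Mathlib
import HarnessLib
import Summits.HubbardSuperconductivity.HubbardSuperconductivity.Theorems.EnslavedA1gIdentity
import Summits.HubbardSuperconductivity.HubbardSuperconductivity.Theorems.EnslavedA1gLowerSandwich
import Summits.HubbardSuperconductivity.HubbardSuperconductivity.Theorems.ThermalWedgeTwSeededEnsembleEquivalenceBarrierEtaTower
import Summits.HubbardSuperconductivity.HubbardSuperconductivity.Theorems.LiebTwinNoOnsiteODLROPseudospinCeiling
import Summits.HubbardSuperconductivity.HubbardSuperconductivity.Theorems.LiebTwinNoOnsiteODLROPairFieldCommutators

/-!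
# Crux `NoOnsiteODLRO` (stmt-HubbardSuperconductivity-0933), line `registered` — helper stub T5
# `stub_compressibilitySandwich`: the two-sided Yang sandwich

THE COMPRESSIBILITY SANDWICH (crux census T5). For `U ≥ 0`, `L` even with `L ≥ 3`, `2 ≤ N`,
`N + 2 ≤ L²` and a normalised ground state `ψ` of `H = hubbardTorus 2 L 1 U` in the joint sector
`(N, S^z = 0)`, with `E_M = minEnergyOn H (szSector M 0)`, `S = Re⟨ψ, P_sᴴ P_s ψ⟩` (`P_s = pairField sWave L`),
`T = hubbardTorus 2 L 1 0` and the pair windows `κ₊ = U - (E_{N+2} - E_N)`, `κ₋ = U - (E_N - E_{N-2})`: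

  `(E_{N+2} - 2 E_N + E_{N-2}) · S ≤ 2 κ₊ (L² - N) - 4 Re⟨ψ, T ψ⟩`

(`stub_compressibilitySandwich`): the discrete pair compressibility `κ₋ - κ₊ = E_{N+2} - 2E_N + E_{N-2}`
controls the on-site pair structure factor by removal-side data only.

Proof.
* LOWER (removal) side, landed: `κ₋ S ≤ 2X`, `X = Re⟨P_s ψ, P_{s'} ψ⟩` (`enslavedA1gLowerSandwich_proof`, (ii)).
* ADDITION side: the conjugate-transposed enslaving identity `2 P_{s'}ᴴ = P_sᴴ H - H P_sᴴ + U P_sᴴ`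
  (`enslavedA1gIdentity_proof`, `H` Hermitian) applied to `ψ` gives `H φ = (E_N + U) φ - 2 P_{s'}ᴴ ψ` for
  `φ = P_sᴴ ψ = -√2 η₁† ψ ∈ szSector (N+2) 0` (`etaTower_pairField_sWave_eq`, `isInSector_etaRaise_mulVec`),
  and the variational principle in that sector (`szSector_groundState`) yields
  `2 Re⟨φ, P_{s'}ᴴ ψ⟩ ≤ κ₊ ‖φ‖²`.
* COMMUTATORS move the addition-side quantities to the removal side:
  `‖φ‖² = 2 ‖η₁† ψ‖² = 2 ‖η₁ ψ‖² + 2 (L² - N) = S + 2 (L² - N)` (Yang, `star_etaRaise_mulVec_dotProduct_self`),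
  and `⟨φ, P_{s'}ᴴ ψ⟩ = ⟨ψ, P_s P_{s'}ᴴ ψ⟩ = ⟨ψ, P_{s'}ᴴ P_s ψ⟩ + 2⟨ψ, T ψ⟩` by `[P_s, P_{s'}ᴴ] = 2T`
  (`stub_pairFieldCommutators`), whose real part is `X + 2 Re⟨ψ, T ψ⟩`.
* Combine: `κ₋ S ≤ 2X ≤ κ₊ (S + 2(L² - N)) - 4 Re⟨ψ, T ψ⟩`.

Sources: C. N. Yang, PRL 63 (1989) 2144 (`η` pairing, `[η, η†]`); S. C. Zhang, PRB 42 (1990) 1012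
(pseudospin constraint / sum rule); G.-S. Tian, J. Phys. A 27 (1994) 6677 (off-half-filling bounds on
on-site pairing correlations); H. Tasaki (2020) §2.1 (variational principle). The combination is the
crux census by-product T5; every ingredient is a proved tree lemma. No definition is introduced.
-/

noncomputable section

namespace Summit.HubbardSuperconductivity.NoOnsiteODLRO.Sandwich

open Matrix Finset
open scoped ComplexOrder
open Literature.Probability.LatticeModels Literature.MathematicalPhysics.QuantumLattice
open Summit.HubbardSuperconductivity.EnslavedA1g
open Summit.HubbardSuperconductivity.HubbardSuperconductivity.Theorems.TwSeededEnsembleEquivalence.ExposedDensity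
  (etaTower_pairField_sWave_eq)
open Summit.HubbardSuperconductivity.HubbardSuperconductivity.Theorems.NoOnsiteODLRO.Pseudospin
  (re_expect_pairField_sWave_eq)

/-! ### Scalar and norm bookkeeping for `P_s = -√2 η₁` -/

/-- `Re (2 z) = 2 Re z`. [folklore] -/
theorem re_two_mul (z : ℂ) : ((2 : ℂ) * z).re = 2 * z.re := by
  simp [Complex.mul_re]

/-- `star (-√2) · (-√2) = 2` in `ℂ`. [folklore] -/
theorem star_neg_sqrt_two_mul_self :
    star (-((Real.sqrt 2 : ℝ) : ℂ)) * (-((Real.sqrt 2 : ℝ) : ℂ)) = ((2 : ℝ) : ℂ) := by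
  rw [star_neg, Complex.star_def, Complex.conj_ofReal, neg_mul_neg, ← Complex.ofReal_mul,
    Real.mul_self_sqrt zero_le_two]

/-- `Re⟨-√2 u, -√2 w⟩ = 2 Re⟨u, w⟩` (`star (-√2) · (-√2) = 2`). [folklore] -/
theorem re_dotProduct_neg_sqrt_two_smul {n : Type*} [Fintype n] (u w : n → ℂ) :
    (star ((-((Real.sqrt 2 : ℝ) : ℂ)) • u) ⬝ᵥ ((-((Real.sqrt 2 : ℝ) : ℂ)) • w)).re =
      2 * (star u ⬝ᵥ w).re := by
  rw [star_smul, smul_dotProduct, dotProduct_smul, smul_smul, star_neg_sqrt_two_mul_self, smul_eq_mul,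
    Complex.re_ofReal_mul]

section Norms

variable {L : ℕ} [NeZero L]

/-- `P_sᴴ ψ = -√2 · η₁† ψ` (`η₁† = etaRaise 1`, `(etaLower 1)ᴴ = etaRaise 1`, `√2` real).
Yang, PRL 63 (1989) 2144, eq. (4). [folklore] -/
theorem pairField_sWave_conjTranspose_mulVec (ψ : Fock (Orb (FermionTorus 2 L))) :
    (pairField sWave L)ᴴ *ᵥ ψ =
      (-((Real.sqrt 2 : ℝ) : ℂ)) • (etaRaise (fun _ : FermionTorus 2 L => (1 : ℤˣ)) *ᵥ ψ) := by
  rw [etaTower_pairField_sWave_eq, conjTranspose_smul, star_neg, Complex.star_def, Complex.conj_ofReal,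
    etaLower, conjTranspose_conjTranspose, smul_mulVec]

/-- **`‖P_sᴴ ψ‖² = S + 2 (L² - N) ‖ψ‖²`** for an `N`-particle `ψ`: `‖P_sᴴψ‖² = 2‖η₁†ψ‖²` and Yang's
`‖η†φ‖² = ‖ηφ‖² + (|Λ| - N)‖φ‖²` (`star_etaRaise_mulVec_dotProduct_self`), `|Λ| = L²`.
Yang, PRL 63 (1989) 2144, eq. (5). [folklore] -/
theorem re_norm_pairField_sWave_conjTranspose_mulVec {N : ℕ} {ψ : Fock (Orb (FermionTorus 2 L))}
    (hψ : IsNParticle N ψ) :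
    (star ((pairField sWave L)ᴴ *ᵥ ψ) ⬝ᵥ ((pairField sWave L)ᴴ *ᵥ ψ)).re =
      (expect ((pairField sWave L)ᴴ * pairField sWave L) ψ).re +
        2 * ((L : ℝ) ^ 2 - N) * (star ψ ⬝ᵥ ψ).re := by
  have hcoef : ((Fintype.card (FermionTorus 2 L) : ℂ) - (N : ℂ)) = ((((L : ℝ) ^ 2 - N : ℝ)) : ℂ) := by
    rw [card_fermionTorus]
    push_cast
    ring
  rw [pairField_sWave_conjTranspose_mulVec, re_dotProduct_neg_sqrt_two_smul,
    star_etaRaise_mulVec_dotProduct_self _ hψ, re_expect_pairField_sWave_eq, Complex.add_re, hcoef,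
    Complex.re_ofReal_mul]
  ring

/-- **`Re⟨P_sᴴ ψ, P_{s'}ᴴ ψ⟩ = Re⟨P_s ψ, P_{s'} ψ⟩ + 2 Re⟨ψ, T ψ⟩`** (`L ≥ 3`), from
`[P_s, P_{s'}ᴴ] = 2T` (`stub_pairFieldCommutators`) and `Re⟨a, b⟩ = Re⟨b, a⟩`.
Zhang, PRB 42 (1990) 1012; Yang, PRL 63 (1989) 2144. [folklore] -/
theorem re_dotProduct_conjTranspose_mulVec_pairFields (hL : 2 < L) (ψ : Fock (Orb (FermionTorus 2 L))) :
    (star ((pairField sWave L)ᴴ *ᵥ ψ) ⬝ᵥ ((pairField extendedSWave L)ᴴ *ᵥ ψ)).re =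
      (expect ((pairField sWave L)ᴴ * pairField extendedSWave L) ψ).re +
        2 * (expect (hubbardTorus 2 L 1 0) ψ).re := by
  have hc : pairField sWave L * (pairField extendedSWave L)ᴴ =
      (2 : ℂ) • hubbardTorus 2 L 1 0 + (pairField extendedSWave L)ᴴ * pairField sWave L :=
    sub_eq_iff_eq_add.1 (stub_pairFieldCommutators L hL)
  have h1 : star ((pairField sWave L)ᴴ *ᵥ ψ) ⬝ᵥ ((pairField extendedSWave L)ᴴ *ᵥ ψ) =
      expect (pairField sWave L * (pairField extendedSWave L)ᴴ) ψ := by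
    rw [← PosSemidefTrace.expect_conjTranspose_mul, conjTranspose_conjTranspose]
  have h2 : (star (pairField extendedSWave L *ᵥ ψ) ⬝ᵥ (pairField sWave L *ᵥ ψ)).re =
      (star (pairField sWave L *ᵥ ψ) ⬝ᵥ (pairField extendedSWave L *ᵥ ψ)).re := by
    rw [Matrix.star_dotProduct, Complex.star_def, Complex.conj_re]
  rw [h1, hc, expect_add, expect_smul, Complex.add_re, re_two_mul,
    PosSemidefTrace.expect_conjTranspose_mul (pairField extendedSWave L) (pairField sWave L) ψ, h2,
    PosSemidefTrace.expect_conjTranspose_mul (pairField sWave L) (pairField extendedSWave L) ψ]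
  ring

end Norms

/-! ### The stub -/

section Main

/-- **Helper stub T5 of line `registered` for crux `NoOnsiteODLRO` — the compressibility (two-sided Yang)
sandwich.** For `U ≥ 0`, even `L ≥ 3`, `2 ≤ N`, `N + 2 ≤ L²` and a normalised ground state `ψ` of
`H = hubbardTorus 2 L 1 U` in the sector `(N, S^z = 0)`:
`(E_{N+2} - 2E_N + E_{N-2}) · Re⟨ψ, P_sᴴP_sψ⟩ ≤ 2 (U - (E_{N+2} - E_N)) (L² - N) - 4 Re⟨ψ, Tψ⟩`,
`E_M = minEnergyOn H (szSector M 0)`, `P_s = pairField sWave L`, `T = hubbardTorus 2 L 1 0`. Lower side: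
`enslavedA1gLowerSandwich_proof` (ii); addition side: conjugate-transposed enslaving identity + variational
principle in `szSector (N+2) 0`; transfer by `‖P_sᴴψ‖² = S + 2(L² - N)` and `[P_s, P_{s'}ᴴ] = 2T`.
Yang, PRL 63 (1989) 2144; Zhang, PRB 42 (1990) 1012; Tian, J. Phys. A 27 (1994) 6677. [folklore] -/
theorem stub_compressibilitySandwich :
    ∀ (U : ℝ), 0 ≤ U → ∀ (L : ℕ) [NeZero L], Even L → 2 < L →
      ∀ (N : ℕ) (ψ : Fock (Orb (FermionTorus 2 L))), 2 ≤ N → N + 2 ≤ L ^ 2 → star ψ ⬝ᵥ ψ = 1 →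
        IsGroundStateInSector (hubbardTorus 2 L 1 U) N 0 ψ →
        ((hubbardTorus 2 L 1 U).minEnergyOn (szSector (Λ := FermionTorus 2 L) (N + 2) 0) -
              2 * (hubbardTorus 2 L 1 U).minEnergyOn (szSector (Λ := FermionTorus 2 L) N 0) +
            (hubbardTorus 2 L 1 U).minEnergyOn (szSector (Λ := FermionTorus 2 L) (N - 2) 0)) *
            (expect ((pairField sWave L)ᴴ * pairField sWave L) ψ).re ≤
          2 * (U - ((hubbardTorus 2 L 1 U).minEnergyOn (szSector (Λ := FermionTorus 2 L) (N + 2) 0) -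
                (hubbardTorus 2 L 1 U).minEnergyOn (szSector (Λ := FermionTorus 2 L) N 0))) *
              ((L : ℝ) ^ 2 - N) -
            4 * (expect (hubbardTorus 2 L 1 0) ψ).re := by
  intro U hU L _ hLeven hL N ψ hN2 hNL hψ1 hGS
  -- (a) the LOWER (removal-side) sandwich, conjunct (ii)
  have hlow' := enslavedA1gLowerSandwich_proof U hU L hLeven hL N ψ hN2 (by omega) hψ1 hGS
  dsimp only at hlow'
  obtain ⟨-, hlow, -⟩ := hlow'
  obtain ⟨hmem, hne, hHψ⟩ := hGS
  -- `N = 2(m+1)`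
  obtain ⟨n, rfl, -⟩ :=
    Summit.HubbardSuperconductivity.HubbardSuperconductivity.Theorems.WcbcsSlater.exists_eq_two_mul_of_mem_szSector_zero
      hmem hne
  obtain ⟨m, rfl⟩ : ∃ m, n = m + 1 := ⟨n - 1, by omega⟩
  have h2p : 2 * (m + 1) + 2 = 2 * (m + 2) := by ring
  rw [h2p]
  have hcard : Fintype.card (FermionTorus 2 L) = L ^ 2 := card_fermionTorus 2 L
  have hψsec : IsInSector (m + 1) (m + 1) ψ := (mem_szSector_two_mul_zero_iff (m + 1) ψ).1 hmem
  -- (b) the conjugate-transposed enslaving identity: `2 P_{s'}ᴴ = P_sᴴ H - H P_sᴴ + U P_sᴴ`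
  have hHerm : (hubbardTorus 2 L 1 U)ᴴ = hubbardTorus 2 L 1 U :=
    (LiebThm1.hamiltonian_isHermitian (fermionTorusGraph 2 L) 1 U).eq
  have hidct : (2 : ℂ) • (pairField extendedSWave L)ᴴ =
      (pairField sWave L)ᴴ * hubbardTorus 2 L 1 U - hubbardTorus 2 L 1 U * (pairField sWave L)ᴴ +
        (U : ℂ) • (pairField sWave L)ᴴ := by
    have h := congrArg Matrix.conjTranspose (enslavedA1gIdentity_proof L hL U)
    rw [conjTranspose_smul, conjTranspose_add, conjTranspose_sub, conjTranspose_mul, conjTranspose_mul,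
      conjTranspose_smul, hHerm] at h
    have h2 : star (2 : ℂ) = 2 := by rw [Complex.star_def, map_ofNat]
    have hUs : star (U : ℂ) = U := by rw [Complex.star_def, Complex.conj_ofReal]
    rw [h2, hUs] at h
    exact h
  -- applied to `ψ`: `H φ = E_N φ + U φ - 2 P_{s'}ᴴ ψ` for `φ = P_sᴴ ψ`
  have hHφ : hubbardTorus 2 L 1 U *ᵥ ((pairField sWave L)ᴴ *ᵥ ψ) =
      (((hubbardTorus 2 L 1 U).minEnergyOn (szSector (Λ := FermionTorus 2 L) (2 * (m + 1)) 0) : ℝ) : ℂ) •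
          ((pairField sWave L)ᴴ *ᵥ ψ) +
        (U : ℂ) • ((pairField sWave L)ᴴ *ᵥ ψ) - (2 : ℂ) • ((pairField extendedSWave L)ᴴ *ᵥ ψ) := by
    have h := congrArg (fun M => M *ᵥ ψ) hidct
    rw [smul_mulVec, add_mulVec, sub_mulVec, ← mulVec_mulVec, ← mulVec_mulVec, hHψ, mulVec_smul,
      smul_mulVec] at h
    rw [h]
    abel
  -- abbreviations
  set H := hubbardTorus 2 L 1 U with hHdef
  set E : ℝ := H.minEnergyOn (szSector (2 * (m + 1)) 0) with hEdef
  set Em : ℝ := H.minEnergyOn (szSector (2 * (m + 1) - 2) 0) with hEmdef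
  set Ep : ℝ := H.minEnergyOn (szSector (2 * (m + 2)) 0) with hEpdef
  set φ := (pairField sWave L)ᴴ *ᵥ ψ with hφdef
  set v' := (pairField extendedSWave L)ᴴ *ᵥ ψ with hv'def
  -- `φ ∈ szSector (N+2) 0`
  have hφsec : IsInSector (m + 2) (m + 2) φ := by
    rw [hφdef, pairField_sWave_conjTranspose_mulVec]
    exact (isInSector_etaRaise_mulVec hψsec _).smul _
  -- the variational principle in the sector `(N+2, 0)`
  have hm2 : m + 2 ≤ Fintype.card (FermionTorus 2 L) := by rw [hcard]; omega
  have hvar : Ep * (star φ ⬝ᵥ φ).re ≤ (expect H φ).re :=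
    (szSector_groundState (fermionTorusGraph 2 L) 1 U hm2).2 φ hφsec
  -- ADDITION side: `2 Re⟨φ, v'⟩ ≤ κ₊ ‖φ‖²`
  have hadd : 2 * (star φ ⬝ᵥ v').re ≤ (U - (Ep - E)) * (star φ ⬝ᵥ φ).re := by
    have h1 : (expect H φ).re = (E + U) * (star φ ⬝ᵥ φ).re - 2 * (star φ ⬝ᵥ v').re := by
      unfold Literature.MathematicalPhysics.QuantumLattice.expect
      rw [hHφ]
      simp only [dotProduct_sub, dotProduct_add, dotProduct_smul, smul_eq_mul, Complex.sub_re,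
        Complex.add_re, Complex.re_ofReal_mul, re_two_mul]
      ring
    rw [h1] at hvar
    linarith
  -- (c) transfer to the removal side
  have hφnorm : (star φ ⬝ᵥ φ).re =
      (expect ((pairField sWave L)ᴴ * pairField sWave L) ψ).re +
        2 * ((L : ℝ) ^ 2 - ((2 * (m + 1) : ℕ) : ℝ)) := by
    have hψN : IsNParticle (2 * (m + 1)) ψ := by
      have h := hψsec.isNParticle
      rwa [← two_mul] at h
    rw [hφdef, re_norm_pairField_sWave_conjTranspose_mulVec hψN, hψ1, Complex.one_re, mul_one]
  have hX : (star φ ⬝ᵥ v').re =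
      (expect ((pairField sWave L)ᴴ * pairField extendedSWave L) ψ).re +
        2 * (expect (hubbardTorus 2 L 1 0) ψ).re :=
    re_dotProduct_conjTranspose_mulVec_pairFields hL ψ
  -- (d) combine: `κ₋ S ≤ 2X ≤ κ₊ (S + 2(L² - N)) - 4 Re⟨ψ, Tψ⟩`
  rw [hφnorm, hX] at hadd
  linarith

end Main

end Summit.HubbardSuperconductivity.NoOnsiteODLRO.Sandwich

end
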